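import Mathlib.RingTheory.MvPolynomial.EulerIdentity
import Literature.Computability.AlgebraicComplexity.ProjectedShiftedPartials
import HarnessLib

/-!
# Trivial caps on the projected shifted partials measure `Φ_{ℳ,m}` (Kumar–Saraf 2017, Def. 3.1)

Topic `Literature/Computability/AlgebraicComplexity`; small API complement to
`ProjectedShiftedPartials.lean`. The measure `KumarSaraf.pspDim Ls m f = dim ⟨σ(x^S · ∂_L f)⟩` is
bounded

* by the NUMBER OF GENERATORS: `pspDim_le_card_mul_choose` (`≤ |ι| · C(N, m)`) and, sharper,
  `pspDim_le_card_mul_choose_of_mem` (`≤ |D| · C(N, m)` whenever all derivatives `∂_{Ls i} f` lie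
  in a finite set `D` — e.g. the `C(n,r)²` minors of order `n - r` for `per_n`, `det_n`);
* by the NUMBER OF MONOMIALS: `pspDim_le_choose_of_isHomogeneous` — for `f` homogeneous of degree
  `d` and order-`r` operators every generator is a combination of MULTILINEAR monomials of degree
  exactly `m + (d - r)`, so `Φ ≤ C(N, m + (d - r))` (`N = |σ|`);

together with `isHomogeneous_iterPderiv` (iterated derivatives of a homogeneous polynomial are
homogeneous, degree dropping by the order, truncated). These are the two caps against which any
lower bound for `Φ` (Kumar–Saraf 2017, §5, §8.5; the crux line `Depth4HomFour/birth` of the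
ValiantsHypothesis programme) has to be calibrated: a claimed inequality `X < Φ_{ℳ,m}(f)` is only
consistent if `X < min (|D|·C(N,m), C(N, m+d-r))`.

Everything is proved; no named facts.

## References

* M. Kumar, S. Saraf, *On the power of homogeneous depth 4 arithmetic circuits*, SIAM J. Comput.
  46 (2017) 336–387 (arXiv:1404.1950): Def. 3.1 (the measure), §5.1 (trivial bounds used in the
  calibration of Lemma 8.9).
-/

noncomputable section

open MvPolynomial

namespace Literature.Computability.AlgebraicComplexity.KumarSaraf

open GKKS

variable {K : Type*} [Field K] {σ : Type*}

/-- **Iterated derivatives preserve homogeneity**: if `f` is homogeneous of degree `d`, then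
`∂_L f` is homogeneous of degree `d - |L|` (truncated subtraction: for `|L| > d` the derivative is
a constant, then `0`). [folklore] -/
theorem isHomogeneous_iterPderiv {f : MvPolynomial σ K} {d : ℕ} (hf : f.IsHomogeneous d)
    (L : List σ) : (iterPderiv L f).IsHomogeneous (d - L.length) := by
  induction L with
  | nil => simpa using hf
  | cons v L ih =>
    rw [iterPderiv_cons, List.length_cons, ← Nat.sub_sub]
    exact ih.pderiv

variable [Fintype σ]

/-- **Cap by the number of generators**: `Φ_{ℳ,m}(f) ≤ |ι| · C(N, m)` — the space is spanned by
the `|ι| · C(N, m)` generators `σ(x^S · ∂_{Ls i} f)`. [folklore] -/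
theorem pspDim_le_card_mul_choose {ι : Type*} [Fintype ι] (Ls : ι → List σ) (m : ℕ)
    (f : MvPolynomial σ K) :
    pspDim Ls m f ≤ Fintype.card ι * (Fintype.card σ).choose m := by
  classical
  calc pspDim Ls m f ≤ Fintype.card (ι × {S : Finset σ // S.card = m}) :=
        finrank_range_le_card _
    _ = Fintype.card ι * (Fintype.card σ).choose m := by
        rw [Fintype.card_prod, Fintype.card_finset_len]

/-- **Cap by the number of DISTINCT derivatives**: if every derivative `∂_{Ls i} f` lies in a
finite set `D`, then `Φ_{ℳ,m}(f) ≤ |D| · C(N, m)` (generators with equal derivative and equal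
shift coincide). For `per_n` / `det_n` and order-`r` operators one may take for `D` the minors of
order `n - r` together with `0`, `|D| ≤ C(n,r)² + 1`. [folklore] -/
theorem pspDim_le_card_mul_choose_of_mem {ι : Type*} (Ls : ι → List σ) (m : ℕ)
    (f : MvPolynomial σ K) (D : Finset (MvPolynomial σ K)) (hD : ∀ i, iterPderiv (Ls i) f ∈ D) :
    pspDim Ls m f ≤ D.card * (Fintype.card σ).choose m := by
  classical
  set F : Finset (MvPolynomial σ K) :=
    (D ×ˢ (Finset.univ : Finset {S : Finset σ // S.card = m})).image
      fun p => mlProj K (monomial (chi (p.2 : Finset σ)) (1 : K) * p.1) with hF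
  have hsub : Set.range (pspGen Ls m f) ⊆ (F : Set (MvPolynomial σ K)) := by
    rintro _ ⟨⟨i, S⟩, rfl⟩
    rw [Finset.mem_coe, hF, Finset.mem_image]
    exact ⟨(iterPderiv (Ls i) f, S), Finset.mem_product.2 ⟨hD i, Finset.mem_univ _⟩, rfl⟩
  haveI : Module.Finite K (Submodule.span K (F : Set (MvPolynomial σ K))) :=
    Module.Finite.span_of_finite K F.finite_toSet
  calc pspDim Ls m f
      ≤ Module.finrank K (Submodule.span K (F : Set (MvPolynomial σ K))) :=
        Submodule.finrank_mono (Submodule.span_mono hsub)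
    _ ≤ F.card := finrank_span_finset_le_card F
    _ ≤ (D ×ˢ (Finset.univ : Finset {S : Finset σ // S.card = m})).card := Finset.card_image_le
    _ = D.card * (Fintype.card σ).choose m := by
        rw [Finset.card_product, Finset.card_univ, Fintype.card_finset_len]

/-- **Cap by the number of monomials**: for `f` homogeneous of degree `d` and derivative operators
of order `r`, every generator `σ(x^S · ∂_L f)` (`|S| = m`) is a linear combination of multilinear
monomials `x^T`, `|T| = m + (d - r)`, hence `Φ_{ℳ,m}(f) ≤ C(N, m + (d - r))`. [folklore] -/
theorem pspDim_le_choose_of_isHomogeneous {ι : Type*} (Ls : ι → List σ) (r : ℕ)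
    (hLs : ∀ i, (Ls i).length = r) (m : ℕ) {f : MvPolynomial σ K} {d : ℕ}
    (hf : f.IsHomogeneous d) :
    pspDim Ls m f ≤ (Fintype.card σ).choose (m + (d - r)) := by
  classical
  set e : ℕ := m + (d - r) with he
  set F : Finset (MvPolynomial σ K) :=
    (Finset.powersetCard e (Finset.univ : Finset σ)).image fun T => monomial (chi T) (1 : K)
    with hF
  have hgen : ∀ p, pspGen Ls m f p ∈ Submodule.span K (F : Set (MvPolynomial σ K)) := by
    rintro ⟨i, S, hS⟩
    set g : MvPolynomial σ K := monomial (chi S) (1 : K) * iterPderiv (Ls i) f with hg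
    have hhom : g.IsHomogeneous e := by
      have h1 : (monomial (chi S) (1 : K)).IsHomogeneous m :=
        isHomogeneous_monomial _ (by rw [degree_chi, hS])
      have h2 := isHomogeneous_iterPderiv hf (Ls i)
      rw [hLs i] at h2
      exact h1.mul h2
    change mlProj K g ∈ _
    have hml : mlProj K g = ∑ β ∈ g.support.filter IsML, monomial β (coeff β g) := rfl
    rw [hml]
    refine Submodule.sum_mem _ fun β hβ => ?_
    obtain ⟨hβs, hβml⟩ := Finset.mem_filter.1 hβ
    have hdeg : β.degree = e := by
      by_contra hne
      exact (mem_support_iff.1 hβs) (hhom.coeff_eq_zero hne)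
    have hmono : monomial β (coeff β g) = coeff β g • monomial (chi β.support) (1 : K) := by
      rw [hβml.chi_support, smul_monomial, smul_eq_mul, mul_one]
    rw [hmono]
    refine Submodule.smul_mem _ _ (Submodule.subset_span ?_)
    rw [Finset.mem_coe, hF, Finset.mem_image]
    refine ⟨β.support, ?_, rfl⟩
    rw [Finset.mem_powersetCard]
    exact ⟨Finset.subset_univ _, by rw [← hβml.degree_eq_card_support, hdeg]⟩
  have hle : pspSpan Ls m f ≤ Submodule.span K (F : Set (MvPolynomial σ K)) :=
    Submodule.span_le.2 (by rintro _ ⟨p, rfl⟩; exact hgen p)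
  haveI : Module.Finite K (Submodule.span K (F : Set (MvPolynomial σ K))) :=
    Module.Finite.span_of_finite K F.finite_toSet
  calc pspDim Ls m f
      ≤ Module.finrank K (Submodule.span K (F : Set (MvPolynomial σ K))) :=
        Submodule.finrank_mono hle
    _ ≤ F.card := finrank_span_finset_le_card F
    _ ≤ (Finset.powersetCard e (Finset.univ : Finset σ)).card := Finset.card_image_le
    _ = (Fintype.card σ).choose (m + (d - r)) := by
        rw [Finset.card_powersetCard, Finset.card_univ]

end Literature.Computability.AlgebraicComplexity.KumarSaraf

end
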